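import Summits.FinalStateConjecture.FinalStateConjecture.Theorems.ZeroEnergyKerrOrBombStationaryLimitReductionKerrIsometryRigidityWave3EndMatching
import Literature.Geometry.Lorentzian.KerrKillingAlgebraProofs
import Literature.Geometry.Lorentzian.KerrBackwardsIsometryProofs
import Literature.Geometry.Lorentzian.SchwarzschildKillingAlgebraProofs
import Literature.Geometry.Lorentzian.LocalConstraintDeformation
import HarnessLib

/-!
# Route ZeroEnergyKerrOrBomb · crux `StationaryLimitReduction` (stmt-FinalStateConjecture-10021), line
# `symplectic-dual-of-the-bomb` — the three Kerr/Schwarzschild literature inputs of stub 1R are DISCHARGED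

Helper file (`--supports stmt-FinalStateConjecture-10021`) of the co-lead prover-line-stmt-FinalStateConjecture-10021-c4-0
(lineage 0), 2026-08-16, for lineage a's reshape r6 (`…SymplecticDualOfTheBombSig6`, p126956). Of the four cited
Literature named facts bundled in `Sig6.stub_citedFacts`, three are now theorems of the tree:

* `ONeill1995_kerrKillingFields_holds` (`Literature/Geometry/Lorentzian/KerrKillingAlgebraProofs.lean`): the Killing
  algebra of the rotating sub-extremal Kerr exterior is `ℝ ∂_{t*} ⊕ ℝ ∂_φ`;
* `StephaniEtAl2003_schwarzschildKillingFields_holds` (`…/SchwarzschildKillingAlgebraProofs.lean`, p129316): the Killing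
  algebra of the Schwarzschild exterior is `ℝ ∂_{t*} ⊕ so(3)`;
* `ONeill1995_kerrBackwardsIsometry_holds` (`…/KerrBackwardsIsometryProofs.lean`, p127724): the involutive isometry of the
  Kerr exterior reversing `∂_{t*}`.

Consequences recorded here (pure logic over the landed reductions of wave 3, `…KerrIsometryRigidityWave3EndMatching`,
p126702; the `Sig6` module is not imported because the farm has not built it yet):

* `kerrEndMatching_holds` — **F0 `KerrEndMatching` holds UNCONDITIONALLY** (`kerrEndMatching_of_killingAlgebras` with the two
  Killing-algebra facts discharged);
* `kerrIsometryRigidity_of_residuals` — **stub 1R `Sig4.stub_kerrIsometryRigidity` now follows from its two geometric residuals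
  `KerrHorizonExtension`, `KerrAsymptoticRigidity` ALONE** (= `Sig6.stub_kerrIsometryResiduals`; no literature debt left in 1R);
* `citedFacts_of_chruscielDelay` — the conjunction registered as `Sig6.stub_citedFacts` (written out) reduces to its last
  conjunct `ChruscielDelay_localConstraintDeformation` (consumed only by stub 4).

References: B. O'Neill, *The Geometry of Kerr Black Holes* (1995), §3.1, §3.7 Cor. 3.7.4; H. Stephani et al., *Exact
Solutions of Einstein's Field Equations* (2003), §15.4, §38.2; P. T. Chruściel, E. Delay, Mém. SMF 94 (2003), Thm. 5.9.
-/

-- every `Summit.FinalStateConjecture.FinalStateConjecture.…` name repeats the summit = sub-problem segment (D-0017 layout)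
set_option linter.dupNamespace false

noncomputable section

namespace Summit.FinalStateConjecture.FinalStateConjecture.Theorems.SymplecticDualOfTheBomb

open Literature.Geometry.Lorentzian

/-- **The three Kerr/Schwarzschild literature inputs of stub 1R hold** (Kerr Killing algebra, Schwarzschild Killing
algebra, Kerr backwards isometry — all discharged in `Literature/`). [cite: ONeill1995, Ch. 3 §3.1 and §3.7 Cor. 3.7.4] -/
theorem kerrIsometryRigidity_facts :
    ONeill1995_kerrKillingFields ∧ StephaniEtAl2003_schwarzschildKillingFields ∧ ONeill1995_kerrBackwardsIsometry :=
  ⟨ONeill1995_kerrKillingFields_holds, StephaniEtAl2003_schwarzschildKillingFields_holds,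
    ONeill1995_kerrBackwardsIsometry_holds⟩

/-- **F0 · end matching holds unconditionally**: `KerrEndMatching` (the abstract Kerr isometry sends Kerr's spatial
infinity into the far cylinder of the adapted chart), from the wave-3 theorem `kerrEndMatching_of_killingAlgebras` (p126702)
and the two discharged Killing-algebra facts. [cite: ONeill1995, Ch. 3 §3.7 Cor. 3.7.4] -/
theorem kerrEndMatching_holds : KerrEndMatching :=
  kerrEndMatching_of_killingAlgebras ONeill1995_kerrKillingFields_holds StephaniEtAl2003_schwarzschildKillingFields_holds

/-- **Stub 1R from its geometric residuals alone**: `KerrHorizonExtension → KerrAsymptoticRigidity →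
Sig4.stub_kerrIsometryRigidity` (the wave-3 reduction `stub_kerrIsometryRigidity_of_extension_and_rigidity`, p126702, with
its three literature hypotheses discharged; the antecedent is `Sig6.stub_kerrIsometryResiduals` unbundled).
[cite: ONeill1995, Ch. 3 §3.7 Cor. 3.7.4] -/
theorem kerrIsometryRigidity_of_residuals :
    KerrHorizonExtension → KerrAsymptoticRigidity → Sig4.stub_kerrIsometryRigidity :=
  stub_kerrIsometryRigidity_of_extension_and_rigidity ONeill1995_kerrKillingFields_holds
    StephaniEtAl2003_schwarzschildKillingFields_holds ONeill1995_kerrBackwardsIsometry_holds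

/-- **The literature-debt conjunction of reshape r6 reduces to Chruściel–Delay**:
`ChruscielDelay_localConstraintDeformation` implies the conjunction registered as `Sig6.stub_citedFacts` (written out
verbatim). [cite: ChruscielDelay2003, Thm. 5.9] -/
theorem citedFacts_of_chruscielDelay :
    Literature.Geometry.Lorentzian.ChruscielDelay_localConstraintDeformation →
      ONeill1995_kerrKillingFields ∧ StephaniEtAl2003_schwarzschildKillingFields ∧ ONeill1995_kerrBackwardsIsometry ∧
        Literature.Geometry.Lorentzian.ChruscielDelay_localConstraintDeformation :=
  fun h ↦ ⟨ONeill1995_kerrKillingFields_holds, StephaniEtAl2003_schwarzschildKillingFields_holds,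
    ONeill1995_kerrBackwardsIsometry_holds, h⟩

end Summit.FinalStateConjecture.FinalStateConjecture.Theorems.SymplecticDualOfTheBomb

end
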